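import Summits.Ventures.CertifiedQuantumChemistry.Rows.OccupationBitmasks
import HarnessLib

/-!
# Ventures/CertifiedQuantumChemistry — Rows/OccupationVectorMasks.lean: `Finset (Orb (Fin k))` occupation vectors as bit masks
# (PART 2 of the dictionary for fast kernel evaluation; PART 1 = `Rows/OccupationBitmasks.lean`)

HONEST FRAMING (verbatim): certified bounds for a stated model Hamiltonian in a stated basis; not a
claim about the real molecule beyond that model.

var-2 (gen 16), zero compute, PROVED glue only (0 sorry, no claim node; nothing here asserts a bound about any model).
An occupation-number vector of a `k`-orbital model is presented to the kernel as ONE natural number `m < 4^k` with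
bit `pos (p, σ) = 2p + σ` set iff spin orbital `(p, σ)` is occupied (`σ = 0` up, `1` down) — the rank of `(p, σ)` in
the lexicographic order of `Orb (Fin k) = Fin k ×ₗ Fin 2`, so that Jordan–Wigner counts `#{Q ∈ S | Q < P}` are
pop-counts of low bit segments. Contents: `pos`, `orbAt` (inverse), `onv k m : Finset (Orb (Fin k))` with membership,
injectivity below `2^(2k)` (`eq_of_onv_eq`), `onv` of `&&&`, set differences as masks (`onv_sdiff`), `erase` /
`insert` as `^^^ 2^q`, cardinality `(onv k m).card = (bitSet m (2k)).card`, the Jordan–Wigner filter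
`{Q ∈ onv s | Q < P} = onv (s &&& (2^(pos P) − 1))` and phase `jwSignQ P (onv s) = (−1)^(pc24 …)`, `min'` of a mask
from its lowest set bit, the two-bit occupation vector `onv (2^i ^^^ 2^j) = {orbAt i, orbAt j}` with its `min'`/`max'`,
and sums over `onv s` as the position loop `sumPos` of PART 1. Used by `Rows/SlaterCondonFast.lean`.
-/

namespace Summit.Ventures.CertifiedQuantumChemistry

open Finset
open Literature.MathematicalPhysics.QuantumLattice Literature.MathematicalPhysics.QuantumChemistry

namespace Onv

/-! ## Positions and occupation vectors -/

variable {k : ℕ}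

/-- Bit position of the spin orbital `(p, σ)`: `2p + σ` (its rank in the lexicographic order of `Orb (Fin k)`). -/
def pos (P : Orb (Fin k)) : ℕ := 2 * (ofLex P).1.val + (ofLex P).2.val

/-- `pos P < 2k`. -/
theorem pos_lt (P : Orb (Fin k)) : pos P < 2 * k := by
  unfold pos; have := (ofLex P).1.isLt; have := (ofLex P).2.isLt; omega

/-- `pos` is strictly monotone for the lexicographic order: `pos P < pos Q ↔ P < Q`. -/
theorem pos_lt_pos {P Q : Orb (Fin k)} : pos P < pos Q ↔ P < Q := by
  rw [Prod.Lex.lt_iff, Fin.lt_def, Fin.lt_def, Fin.ext_iff]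
  unfold pos
  have := (ofLex P).2.isLt; have := (ofLex Q).2.isLt
  omega

/-- `pos` is injective. -/
theorem pos_injective : Function.Injective (pos (k := k)) := by
  intro P Q h
  have h1 : ¬ P < Q := fun hlt => by have := pos_lt_pos.2 hlt; omega
  have h2 : ¬ Q < P := fun hlt => by have := pos_lt_pos.2 hlt; omega
  exact le_antisymm (not_lt.1 h2) (not_lt.1 h1)

/-- The spin orbital at position `q < 2k`: `(q / 2, q % 2)`. -/
def orbAt (k q : ℕ) (hq : q < 2 * k) : Orb (Fin k) := orb ⟨q / 2, by omega⟩ ⟨q % 2, by omega⟩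

/-- `pos (orbAt q) = q`. -/
@[simp] theorem pos_orbAt (q : ℕ) (hq : q < 2 * k) : pos (orbAt k q hq) = q := by
  simp only [pos, orbAt, orb, ofLex_toLex]; omega

/-- `orbAt (pos P) = P`. -/
theorem orbAt_pos (P : Orb (Fin k)) : orbAt k (pos P) (pos_lt P) = P :=
  pos_injective (pos_orbAt _ _)

/-- The parity of the position is the spin, its half the spatial orbital. -/
theorem pos_mod_two (P : Orb (Fin k)) : pos P % 2 = (ofLex P).2.val := by
  unfold pos; have := (ofLex P).2.isLt; omega

/-- The half of the position is the spatial orbital. -/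
theorem pos_div_two (P : Orb (Fin k)) : pos P / 2 = (ofLex P).1.val := by
  unfold pos; have := (ofLex P).2.isLt; omega

/-- **The occupation-number vector of a mask**: spin orbital `P` is occupied iff bit `pos P` of `m` is set. -/
def onv (k m : ℕ) : Finset (Orb (Fin k)) := univ.filter fun P => m.testBit (pos P)

/-- Membership in `onv`. -/
@[simp] theorem mem_onv {m : ℕ} {P : Orb (Fin k)} : P ∈ onv k m ↔ m.testBit (pos P) = true := by
  simp [onv]

/-- Masks below `4^k = 2^(2k)` with the same occupation vector are equal. -/
theorem eq_of_onv_eq {m m' : ℕ} (hm : m < 2 ^ (2 * k)) (hm' : m' < 2 ^ (2 * k)) (h : onv k m = onv k m') :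
    m = m' := by
  apply Nat.eq_of_testBit_eq
  intro i
  by_cases hi : i < 2 * k
  · have h1 := Finset.ext_iff.1 h (orbAt k i hi)
    simp only [mem_onv, pos_orbAt] at h1
    rcases hb : m.testBit i with _ | _
    · rcases hb' : m'.testBit i with _ | _
      · rfl
      · exact absurd (h1.2 hb') (by simp [hb])
    · exact (h1.1 hb).symm
  · rw [Nat.testBit_lt_two_pow (lt_of_lt_of_le hm (Nat.pow_le_pow_right (by norm_num) (by omega))),
      Nat.testBit_lt_two_pow (lt_of_lt_of_le hm' (Nat.pow_le_pow_right (by norm_num) (by omega)))]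

/-- `onv` of `&&&` is the intersection. -/
theorem onv_land (m m' : ℕ) : onv k (m &&& m') = onv k m ∩ onv k m' := by
  ext P; simp [Nat.testBit_and]

/-- Set difference as a mask: `onv m' \ onv m = onv (m' &&& (m ^^^ m'))`. -/
theorem onv_sdiff (m m' : ℕ) : onv k m' \ onv k m = onv k (m' &&& (m ^^^ m')) := by
  ext P
  simp only [mem_sdiff, mem_onv, Nat.testBit_and, Nat.testBit_xor, Bool.and_eq_true]
  cases m.testBit (pos P) <;> cases m'.testBit (pos P) <;> simp

/-- The same with the other factor order of `^^^`. -/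
theorem onv_sdiff' (m m' : ℕ) : onv k m \ onv k m' = onv k (m &&& (m ^^^ m')) := by
  rw [onv_sdiff, Nat.xor_comm]

/-- `onv` of a power of two is the singleton of the orbital at that position. -/
theorem onv_two_pow {q : ℕ} (hq : q < 2 * k) : onv k (2 ^ q) = {orbAt k q hq} := by
  ext P
  simp only [mem_onv, Nat.testBit_two_pow, decide_eq_true_eq, mem_singleton]
  constructor
  · intro h; exact pos_injective (by rw [pos_orbAt]; exact h.symm)
  · rintro rfl; simp

/-- Flipping a SET bit erases that orbital. -/
theorem onv_xor_two_pow_of_mem {s q : ℕ} (hq : q < 2 * k) (h : s.testBit q = true) :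
    onv k (s ^^^ 2 ^ q) = (onv k s).erase (orbAt k q hq) := by
  ext P
  simp only [mem_onv, Nat.testBit_xor, Nat.testBit_two_pow, mem_erase]
  by_cases hP : q = pos P
  · have : P = orbAt k q hq := pos_injective (by rw [pos_orbAt]; exact hP.symm)
    subst this
    simp [h]
  · have hne : P ≠ orbAt k q hq := fun h' => hP (by rw [h', pos_orbAt])
    simp [hP, hne]

/-- Flipping a CLEAR bit inserts that orbital. -/
theorem onv_xor_two_pow_of_not_mem {s q : ℕ} (hq : q < 2 * k) (h : s.testBit q = false) :
    onv k (s ^^^ 2 ^ q) = insert (orbAt k q hq) (onv k s) := by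
  ext P
  simp only [mem_onv, Nat.testBit_xor, Nat.testBit_two_pow, mem_insert]
  by_cases hP : q = pos P
  · have : P = orbAt k q hq := pos_injective (by rw [pos_orbAt]; exact hP.symm)
    subst this
    simp [h]
  · have hne : P ≠ orbAt k q hq := fun h' => hP (by rw [h', pos_orbAt])
    simp [hP, hne]

/-- `onv` versus `bitSet`: `P ↦ pos P` is a bijection from `onv k m` onto `bitSet m (2k)`. -/
theorem card_onv (m : ℕ) : (onv k m).card = (bitSet m (2 * k)).card := by
  refine Finset.card_bij' (fun P _ => pos P) (fun q hq => orbAt k q (mem_bitSet.1 hq).1) ?_ ?_ ?_ ?_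
  · intro P hP; exact mem_bitSet.2 ⟨pos_lt P, mem_onv.1 hP⟩
  · intro q hq; simpa using (mem_bitSet.1 hq).2
  · intro P _; exact orbAt_pos P
  · intro q _; exact pos_orbAt _ _

/-- Sums over `onv` as sums over bit positions. -/
theorem sum_onv_eq_sum_bitSet {R : Type*} [AddCommMonoid R] (m : ℕ) (g : ℕ → R) :
    ∑ P ∈ onv k m, g (pos P) = ∑ q ∈ bitSet m (2 * k), g q := by
  refine Finset.sum_bij' (fun P _ => pos P) (fun q hq => orbAt k q (mem_bitSet.1 hq).1) ?_ ?_ ?_ ?_ ?_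
  · intro P hP; exact mem_bitSet.2 ⟨pos_lt P, mem_onv.1 hP⟩
  · intro q hq; simpa using (mem_bitSet.1 hq).2
  · intro P _; exact orbAt_pos P
  · intro q _; exact pos_orbAt _ _
  · intro P _; rfl

/-- The Jordan–Wigner filter as a mask: the occupied orbitals below `P` are the bits of `s` below `pos P`. -/
theorem onv_filter_lt (s : ℕ) (P : Orb (Fin k)) :
    (onv k s).filter (· < P) = onv k (s &&& (2 ^ pos P - 1)) := by
  ext Q
  simp only [mem_filter, mem_onv, Nat.testBit_and, Nat.testBit_two_pow_sub_one, Bool.and_eq_true,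
    decide_eq_true_eq, pos_lt_pos]

/-- **Jordan–Wigner phase of a mask**: `jwSignQ P (onv s) = (−1)^(pc24 (s &&& (2^(pos P) − 1)))` for `s < 2^(2k)`,
`k ≤ 12`. -/
theorem jwSignQ_onv {s : ℕ} (hk : 2 * k ≤ 24) (hs : s < 2 ^ (2 * k)) (P : Orb (Fin k)) :
    Model.jwSignQ P (onv k s) = (-1) ^ pc24 (s &&& (2 ^ pos P - 1)) := by
  rw [Model.jwSignQ, onv_filter_lt, card_onv]
  have hlt : s &&& (2 ^ pos P - 1) < 2 ^ (2 * k) := lt_of_le_of_lt Nat.and_le_left hs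
  rw [← bitSet_eq_of_lt hlt hk, card_bitSet_eq_pc24 (lt_of_lt_of_le hlt (Nat.pow_le_pow_right (by norm_num) hk))]

/-- `min'` of the occupation vector of a mask whose lowest set bit is at `q`. -/
theorem min'_onv_of_decomp {j c : ℕ} (hj : j < 2 * k) (h : (onv k (2 ^ (j + 1) * c + 2 ^ j)).Nonempty) :
    (onv k (2 ^ (j + 1) * c + 2 ^ j)).min' h = orbAt k j hj := by
  refine le_antisymm (Finset.min'_le _ _ ?_) (Finset.le_min' _ _ _ fun Q hQ => ?_)
  · simp [testBit_decomp]
  · rw [mem_onv, testBit_decomp] at hQ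
    simp only [Bool.or_eq_true, decide_eq_true_eq, Bool.and_eq_true] at hQ
    rw [← not_lt, ← pos_lt_pos, pos_orbAt, not_lt]
    rcases hQ with h | ⟨h, -⟩ <;> omega

/-- The occupation vector of a two-bit mask `2^i ^^^ 2^j`, `i < j`. -/
theorem onv_two_pow_xor_two_pow {i j : ℕ} (hij : i < j) (hj : j < 2 * k) :
    onv k (2 ^ i ^^^ 2 ^ j) = {orbAt k i (by omega), orbAt k j hj} := by
  have hdisj : (2 ^ i).testBit j = false := Nat.testBit_two_pow_of_ne (by omega)
  rw [onv_xor_two_pow_of_not_mem hj hdisj, onv_two_pow, Finset.pair_comm]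

/-- `min'` and `max'` of a two-bit occupation vector. -/
theorem min'_max'_onv_two {i j : ℕ} (hij : i < j) (hj : j < 2 * k) (h : (onv k (2 ^ i ^^^ 2 ^ j)).Nonempty) :
    (onv k (2 ^ i ^^^ 2 ^ j)).min' h = orbAt k i (by omega) ∧
      (onv k (2 ^ i ^^^ 2 ^ j)).max' h = orbAt k j hj := by
  have hlt : orbAt k i (by omega) < orbAt k j hj := by rw [← pos_lt_pos]; simp [hij]
  have e := onv_two_pow_xor_two_pow (k := k) hij hj
  have hmem : ∀ Q, Q ∈ onv k (2 ^ i ^^^ 2 ^ j) ↔ Q = orbAt k i (by omega) ∨ Q = orbAt k j hj := by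
    intro Q; rw [e, mem_insert, mem_singleton]
  constructor
  · refine le_antisymm (Finset.min'_le _ _ ((hmem _).2 (Or.inl rfl))) (Finset.le_min' _ _ _ fun Q hQ => ?_)
    rcases (hmem Q).1 hQ with rfl | rfl
    · exact le_rfl
    · exact hlt.le
  · refine le_antisymm (Finset.max'_le _ _ _ fun Q hQ => ?_) (Finset.le_max' _ _ ((hmem _).2 (Or.inr rfl)))
    rcases (hmem Q).1 hQ with rfl | rfl
    · exact hlt.le
    · exact le_rfl

/-- **Sums over `onv s` are position loops**: `Σ_{P ∈ onv s} g (pos P) = sumPos s g (2k)`. -/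
theorem sum_onv_eq_sumPos (s : ℕ) (g : ℕ → ℤ) : ∑ P ∈ onv k s, g (pos P) = sumPos s g (2 * k) := by
  rw [sumPos_eq_sum_bitSet, sum_onv_eq_sum_bitSet]

end Onv

end Summit.Ventures.CertifiedQuantumChemistry
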